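import Summits.Ventures.AbcSig.Recipes.BS04

/-!
# Venture AbcSig — normal forms of primitive solutions ("WLOG one of (i)–(v)", [BS04, p. 26])

HONEST FRAMING. Elementary, fully PROVED lemmas of a COMPUTATION cell (`pub-abcsig`); no claim on ABC or any summit.
[BS04, p. 26] state that a primitive solution of `A xⁿ + B yⁿ = C z²` may be assumed, without loss of generality, to
satisfy one of their conditions (i)–(v) ("we are free to replace `c` by `−c`"; the rôles of `(A, x)` and `(B, y)` are
symmetric). The row theorems need these reductions as actual proofs; this file provides the reusable ones:

* `IsPrimitiveSolution.of_sign` — replacing `c` by `±c`;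
* `exists_sign_sub_four_dvd` — for odd `c` and odd `C` one of `±c` is `≡ C (mod 4)` (cases (iv), (v));
* `pow_emod_four_of_odd` — `xⁿ ≡ x (mod 4)` for odd `x`, odd `n`;
* `not_two_dvd_mul5` — bookkeeping of "`abABC` odd";
* `case_i_or_swap` — if `abABC` is odd then case (i) (`b ≡ −BC (mod 4)`) holds for the datum or for the datum with
  `(A, a)` and `(B, b)` interchanged. (Proof: `A aⁿ + B bⁿ = C c²` is even, so `c` is even and `A a + B b ≡ 0 (mod 4)`;
  a finite check in `ZMod 4`.)

Reference: [BS04] M. A. Bennett, C. M. Skinner, Canad. J. Math. 56 (2004), p. 26–27.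
-/

namespace Summit.Ventures.AbcSig

/-- Replacing `c` by `±c` preserves primitive solutions. -/
theorem IsPrimitiveSolution.of_sign {A B C n : ℕ} {a b c c' : ℤ} (h : IsPrimitiveSolution A B C n a b c)
    (hc' : c' = c ∨ c' = -c) : IsPrimitiveSolution A B C n a b c' := by
  rcases hc' with rfl | rfl
  · exact h
  · exact h.neg

/-- For odd `c` and odd `C`, one of `±c` is congruent to `C` modulo `4`. -/
theorem exists_sign_sub_four_dvd (c : ℤ) (C : ℕ) (hc : ¬ 2 ∣ c) (hC : ¬ 2 ∣ (C : ℤ)) :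
    ∃ c' : ℤ, (c' = c ∨ c' = -c) ∧ (4 : ℤ) ∣ c' - C := by
  by_cases h : (4 : ℤ) ∣ c - C
  · exact ⟨c, Or.inl rfl, h⟩
  · exact ⟨-c, Or.inr rfl, by omega⟩

/-- For odd `x` and odd `n`, `xⁿ ≡ x (mod 4)`. -/
theorem pow_emod_four_of_odd (x : ℤ) (n : ℕ) (hx : ¬ 2 ∣ x) (hn : Odd n) : x ^ n % 4 = x % 4 := by
  rcases (show x % 4 = 1 ∨ x % 4 = 3 by omega) with h | h
  · have h1 : x ≡ 1 [ZMOD 4] := by rw [Int.ModEq]; omega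
    have h2 := h1.pow n
    rw [one_pow, Int.ModEq] at h2
    omega
  · have h1 : x ≡ -1 [ZMOD 4] := by rw [Int.ModEq]; omega
    have h2 := h1.pow n
    rw [hn.neg_one_pow, Int.ModEq] at h2
    omega

/-- "`abABC ≡ 1 (mod 2)`" unpacked into the five parities. -/
theorem not_two_dvd_mul5 {a b : ℤ} {A B C : ℕ} (h : ¬ 2 ∣ a * b * A * B * C) :
    ¬ 2 ∣ a ∧ ¬ 2 ∣ b ∧ ¬ 2 ∣ (A : ℤ) ∧ ¬ 2 ∣ (B : ℤ) ∧ ¬ 2 ∣ (C : ℤ) := by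
  refine ⟨fun h2 => h ?_, fun h2 => h ?_, fun h2 => h ?_, fun h2 => h ?_, fun h2 => h ?_⟩
  · exact ((((h2.mul_right b).mul_right _).mul_right _).mul_right _)
  · exact ((((Dvd.dvd.mul_left h2 a)).mul_right _).mul_right _).mul_right _
  · exact (((Dvd.dvd.mul_left h2 (a * b))).mul_right _).mul_right _
  · exact ((Dvd.dvd.mul_left h2 (a * b * A))).mul_right _
  · exact Dvd.dvd.mul_left h2 (a * b * A * B)

/-- An odd integer is `1` or `3` in `ZMod 4`. -/
theorem intCast_zmod_four_of_odd (x : ℤ) (hx : ¬ 2 ∣ x) : (x : ZMod 4) = 1 ∨ (x : ZMod 4) = 3 := by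
  rcases (show x % 4 = 1 ∨ x % 4 = 3 by omega) with h | h
  · left
    rw [← ZMod.intCast_mod x 4]
    simp [h]
  · right
    rw [← ZMod.intCast_mod x 4]
    simp [h]

/-- In `ZMod 4`, an odd residue raised to an odd power is itself. -/
theorem zmod_four_pow_of_odd (r : ZMod 4) (hr : r = 1 ∨ r = 3) (n : ℕ) (hn : Odd n) : r ^ n = r := by
  rcases hr with rfl | rfl
  · exact one_pow n
  · have h3 : (3 : ZMod 4) = -1 := by decide
    rw [h3, hn.neg_one_pow]

/-- The finite check behind `case_i_or_swap`: for units `x, y, u, v, w` of `ZMod 4` with `u x + v y = w z²`, one of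
`y + v w`, `x + u w` vanishes. -/
theorem zmod_four_case_i_key : ∀ x y u v w z : ZMod 4, (x = 1 ∨ x = 3) → (y = 1 ∨ y = 3) → (u = 1 ∨ u = 3) →
    (v = 1 ∨ v = 3) → (w = 1 ∨ w = 3) → u * x + v * y = w * z ^ 2 → (y + v * w = 0 ∨ x + u * w = 0) := by
  intro x y u v w z hx hy hu hv hw
  revert z
  rcases hx with rfl | rfl <;> rcases hy with rfl | rfl <;> rcases hu with rfl | rfl <;> rcases hv with rfl | rfl <;>
    rcases hw with rfl | rfl <;> decide

/-- **WLOG case (i)** [BS04, p. 26]: if `a b A B C` is odd and `(a, b, c)` is a primitive solution with odd exponent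
`n`, then `b ≡ −BC (mod 4)` or `a ≡ −AC (mod 4)`; i.e. case (i) holds for the datum or for the datum with the rôles
of `(A, a)` and `(B, b)` interchanged. -/
theorem case_i_or_swap {A B C n : ℕ} {a b c : ℤ} (h : IsPrimitiveSolution A B C n a b c) (hn : Odd n)
    (hodd : ¬ 2 ∣ a * b * A * B * C) :
    FreyCase.Holds .i A B C n a b c ∨ FreyCase.Holds .i B A C n b a c := by
  obtain ⟨ha, hb, hA, hB, hC⟩ := not_two_dvd_mul5 hodd
  have hodd' : ¬ 2 ∣ b * a * B * A * C := by
    have : b * a * B * A * C = a * b * A * B * C := by ring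
    rw [this]; exact hodd
  -- cast the equation to `ZMod 4`
  have heqZ := congrArg (fun z : ℤ => (z : ZMod 4)) h.1
  push_cast at heqZ
  have hxa := intCast_zmod_four_of_odd a ha
  have hxb := intCast_zmod_four_of_odd b hb
  have hxA : ((A : ℕ) : ZMod 4) = 1 ∨ ((A : ℕ) : ZMod 4) = 3 := by
    simpa using intCast_zmod_four_of_odd (A : ℤ) hA
  have hxB : ((B : ℕ) : ZMod 4) = 1 ∨ ((B : ℕ) : ZMod 4) = 3 := by
    simpa using intCast_zmod_four_of_odd (B : ℤ) hB
  have hxC : ((C : ℕ) : ZMod 4) = 1 ∨ ((C : ℕ) : ZMod 4) = 3 := by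
    simpa using intCast_zmod_four_of_odd (C : ℤ) hC
  rw [zmod_four_pow_of_odd _ hxa n hn, zmod_four_pow_of_odd _ hxb n hn] at heqZ
  have key := zmod_four_case_i_key (a : ZMod 4) (b : ZMod 4) (A : ZMod 4) (B : ZMod 4) (C : ZMod 4) (c : ZMod 4)
    hxa hxb hxA hxB hxC heqZ
  rcases key with hz | hz
  · left
    refine ⟨hodd, ?_⟩
    have hz' : ((b + (B : ℤ) * (C : ℤ) : ℤ) : ZMod 4) = 0 := by push_cast; exact hz
    exact (ZMod.intCast_zmod_eq_zero_iff_dvd _ 4).mp hz'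
  · right
    refine ⟨hodd', ?_⟩
    have hz' : ((a + (A : ℤ) * (C : ℤ) : ℤ) : ZMod 4) = 0 := by push_cast; exact hz
    exact (ZMod.intCast_zmod_eq_zero_iff_dvd _ 4).mp hz'

end Summit.Ventures.AbcSig
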